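import Mathlib
import HarnessLib
import Literature.Analysis.FluidPDE.KNSSRegularityProofs
import Summits.NavierStokesRegularity.NavierStokesRegularity.Theorems.UnthreadedDoorCapSymDefs
import Summits.NavierStokesRegularity.NavierStokesRegularity.Theorems.UnthreadedDoorCapSymZonalToroidalInduction
import Summits.NavierStokesRegularity.NavierStokesRegularity.Theorems.UnthreadedDoorCapSymZonalToroidalScalarEq
import Summits.NavierStokesRegularity.NavierStokesRegularity.Theorems.UnthreadedDoorCapSymZonalToroidalFamily

/-!
# Route `UnthreadedDoor`, crux `PoloidalLiouville` (stmt-NavierStokesRegularity-1222), WALL W1 `stub_scalarLiouville` —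
# crux idea «capsym-comparison» (ns-idea-13), line input FL-C: `CapSym.zonalToroidalLiouville : CapSym.ZonalToroidalLiouville`

Step (4) of the FL-C handoff plan (`FLC-HANDOFF.md`, evidence on 1222), second half and ASSEMBLY — FL-C is PROVED here:
the linear heart of KNSS Thm 5.2 with a GIVEN zonal drift.  With `B(t) = ∇U(t) × x = f(t) · J`
(`…CapSymZonalToroidalStructure`), the induction equation (`…CapSymZonalToroidalInduction`, p654669) and KNSS (5.10)
(`…CapSymZonalToroidalScalarEq`, p655832) give, through `⟪∂ₜB, Jx⟫ = ϖ² ∂ₜf` (`…CapSymZonalToroidalFamily`), the scalar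
equation `ϖ²(∂ₜf + Df[V] − Δf) = 2(x₀∂₀f + x₁∂₁f)`; its `SO(4)`-lift `f̃(t) = liftAx (f t)` on `ℝ⁵` solves
`∂ₜf̃ + ã·∇f̃ = Δ₅ f̃` pointwise on `]−∞,0[ × ℝ⁵` (off the axis by `sq_mul_laplacian_liftAx` / `liftDeriv_apply_drift`, across
the axis by continuity in `y`), hence in the time-integrated form of `KNSS2009_lemma21_halfball`; the obstruction
`|y₀| |f̃| ≤ ϖ |f| = ‖B‖ ≤ C₀` and `KNSS2009_lemma21_halfball.eq_zero_of_abs_mul_le KNSS2009_lemma21_halfball_holds` give `f̃ ≡ 0`,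
so `f ≡ 0` and `B ≡ 0`.

* `CapSym.liftAx_hasDerivAt_of_scalarEq` — the pointwise lifted equation for ANY jointly smooth family of axisymmetric
  scalars satisfying KNSS (5.10) with a drift `V`;
* `CapSym.liftAx_sub_eq_integral_of_scalarEq` — its time-integrated form (FTC);
* `CapSym.measurable_cutDrift` — joint measurability of the lifted drift cut off at `t ≥ 0`;
* `CapSym.zonalToroidalLiouville : ZonalToroidalLiouville` — FL-C.

The hypothesis `HasNoSwirl (V t)` of FL-C is not used (KNSS (5.10) with a given drift only needs its axisymmetry).
WHAT THIS IS NOT: no NS-regularity statement is touched; this is ONE INPUT (FL-C) of the crux idea card «capsym-comparison»;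
`PoloidalLiouville` (1222), its wall `stub_scalarLiouville` and the summit stay OPEN.  `--supports stmt-NavierStokesRegularity-1222
--as helper`.  [cite: KochNadirashviliSereginSverak2009, Thm 5.2 and its proof (arXiv:0709.3599 pp. 9–10; Acta Math. 203 pp. 97–98), Lemma 2.1 (arXiv p. 5)]
-/

noncomputable section

-- the summit and its single sub-problem share the name (CONVENTIONS §1)
set_option linter.dupNamespace false

open Set Function Filter Topology InnerProductSpace MeasureTheory
open scoped RealInnerProductSpace Laplacian ContDiff

namespace Summit.NavierStokesRegularity.NavierStokesRegularity.Theorems.PoloidalLiouville.CapSym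

open Literature.Analysis Literature.Analysis.FluidPDE

/-! ### The lifted equation `∂ₜf̃ + ã·∇f̃ = Δ₅ f̃`, pointwise and integrated -/

section Lift

variable {f : ℝ → EuclideanSpace ℝ (Fin 3) → ℝ}
  {V : ℝ → EuclideanSpace ℝ (Fin 3) → EuclideanSpace ℝ (Fin 3)}

/-- **The `SO(4)`-lift of KNSS (5.10), pointwise on `]−∞,0[ × ℝ⁵`.**  Let `f` be jointly smooth on `]−∞,0[ × ℝ³` with
axisymmetric slices, `V(t,·)` continuous, and
`ϖ² ∂ₜf = ϖ²(Δf − Df[V]) + 2(x₀∂₀f + x₁∂₁f)` (`ϖ² = x₀² + x₁²`) at every `t < 0`, `x`.  Then for every `t < 0` and EVERY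
`y ∈ ℝ⁵` (axis included) the lift `f̃(s) = liftAx (f s)` satisfies
`∂ₜ f̃(t,y) = Δ₅ f̃(t)(y) − D f̃(t)(y)[ã(t,y)]`, `ã = V₀ Py/|Py| + V₂ e₄` at the meridian point `axisPt y`: off the axis
`{Py = 0}` by `sq_mul_laplacian_liftAx` and `liftDeriv_apply_drift`, on it by continuity in `y` of both sides
(`eq_of_eq_off_ker`). [cite: KochNadirashviliSereginSverak2009, proof of Thm 5.2 (arXiv:0709.3599 p. 10) with (5.10)–(5.12) (p. 9)] -/
theorem liftAx_hasDerivAt_of_scalarEq (hfam : IsSmoothSpaceTimeOn (Iio 0) f)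
    (hfax : ∀ t < 0, IsAxisymmetricScalar (f t)) (hVc : ∀ t < 0, Continuous (V t))
    (hscalar : ∀ t < 0, ∀ x : EuclideanSpace ℝ (Fin 3),
      (x 0 ^ 2 + x 1 ^ 2) * deriv (fun s => f s x) t =
        (x 0 ^ 2 + x 1 ^ 2) * ((Δ (f t)) x - fderiv ℝ (f t) x (V t x)) +
          2 * (x 0 * fderiv ℝ (f t) x (EuclideanSpace.single 0 1) +
            x 1 * fderiv ℝ (f t) x (EuclideanSpace.single 1 1)))
    {t : ℝ} (ht : t < 0) (y : EuclideanSpace ℝ (Fin 5)) :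
    HasDerivAt (fun s => liftAx (f s) y)
      ((Δ (liftAx (f t))) y - fderiv ℝ (liftAx (f t)) y
        ((V t (axisPt y)) 0 • (‖horizProj y‖⁻¹ • horizProj y) +
          (V t (axisPt y)) 2 • EuclideanSpace.single 4 (1 : ℝ))) t := by
  have hft : ContDiff ℝ ∞ (f t) := hfam.contDiff_slice ht
  have hf4 : ContDiff ℝ 4 (f t) := hft.of_le (by norm_cast)
  have hf2 : ContDiff ℝ 2 (f t) := hft.of_le (by norm_cast)
  have hfd : Differentiable ℝ (f t) := hft.differentiable (by simp)
  have hev : IsEvenC 0 (f t) := (hfax t ht).isEvenC_zero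
  have h0 : ∀ x : EuclideanSpace ℝ (Fin 3), x 0 = 0 → fderiv ℝ (f t) x (EuclideanSpace.single 0 1) = 0 :=
    fun x hx => hev.fderiv_single_zero_eq_zero hfd hx
  have h1 : ∀ x : EuclideanSpace ℝ (Fin 3), x 1 = 0 → fderiv ℝ (f t) x (EuclideanSpace.single 1 1) = 0 :=
    fun x hx => (hfax t ht).isEvenC_one.fderiv_single_one_eq_zero hfd hx
  -- the time line through `axisPt y` is differentiable, with derivative continuous in `y`
  have hder : HasDerivAt (fun s => f s (axisPt y)) (deriv (fun s => f s (axisPt y)) t) t :=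
    hfam.hasDerivAt_timeLine isOpen_Iio ht (axisPt y)
  have hg₁ : Continuous fun y' : EuclideanSpace ℝ (Fin 5) => deriv (fun s => f s (axisPt y')) t :=
    ((hfam.isSmoothSpaceTimeOn_deriv isOpen_Iio).contDiff_slice ht).continuous.comp continuous_axisPt
  -- the right-hand side in its continuous-across-the-axis form
  have hform : ∀ y' : EuclideanSpace ℝ (Fin 5),
      (Δ (liftAx (f t))) y' - fderiv ℝ (liftAx (f t)) y'
        ((V t (axisPt y')) 0 • (‖horizProj y'‖⁻¹ • horizProj y') +
          (V t (axisPt y')) 2 • EuclideanSpace.single 4 (1 : ℝ)) =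
      fderiv ℝ (fun z => fderiv ℝ (f t) z (EuclideanSpace.single 0 1)) (axisPt y') (EuclideanSpace.single 0 1) +
        fderiv ℝ (fun z => fderiv ℝ (f t) z (EuclideanSpace.single 2 1)) (axisPt y') (EuclideanSpace.single 2 1) +
        3 * hadamardQuotFst (fun z => fderiv ℝ (f t) z (EuclideanSpace.single 0 1)) (axisPt y') -
        fderiv ℝ (f t) (axisPt y') (V t (axisPt y')) := by
    intro y'
    rw [laplacian_liftAx hf4 hev y', fderiv_liftAx hf2 h0 y', liftDeriv_apply_drift hf2 h0 h1 y' (V t (axisPt y'))]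
  have hg₂ : Continuous fun y' : EuclideanSpace ℝ (Fin 5) =>
      (Δ (liftAx (f t))) y' - fderiv ℝ (liftAx (f t)) y'
        ((V t (axisPt y')) 0 • (‖horizProj y'‖⁻¹ • horizProj y') +
          (V t (axisPt y')) 2 • EuclideanSpace.single 4 (1 : ℝ)) := by
    have heq : (fun y' : EuclideanSpace ℝ (Fin 5) =>
        (Δ (liftAx (f t))) y' - fderiv ℝ (liftAx (f t)) y'
          ((V t (axisPt y')) 0 • (‖horizProj y'‖⁻¹ • horizProj y') +
            (V t (axisPt y')) 2 • EuclideanSpace.single 4 (1 : ℝ))) =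
        fun y' => fderiv ℝ (fun z => fderiv ℝ (f t) z (EuclideanSpace.single 0 1)) (axisPt y')
            (EuclideanSpace.single 0 1) +
          fderiv ℝ (fun z => fderiv ℝ (f t) z (EuclideanSpace.single 2 1)) (axisPt y') (EuclideanSpace.single 2 1) +
          3 * hadamardQuotFst (fun z => fderiv ℝ (f t) z (EuclideanSpace.single 0 1)) (axisPt y') -
          fderiv ℝ (f t) (axisPt y') (V t (axisPt y')) := funext hform
    rw [heq]
    have hsm : ∀ v, ContDiff ℝ ∞ fun z => fderiv ℝ (f t) z v := fun v => contDiff_infty_fderiv_apply hft v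
    have hcii : ∀ i : Fin 3, Continuous fun y' : EuclideanSpace ℝ (Fin 5) =>
        fderiv ℝ (fun z => fderiv ℝ (f t) z (EuclideanSpace.single i 1)) (axisPt y') (EuclideanSpace.single i 1) :=
      fun i => (contDiff_infty_fderiv_apply (hsm _) _).continuous.comp continuous_axisPt
    have hcq : Continuous fun y' : EuclideanSpace ℝ (Fin 5) =>
        hadamardQuotFst (fun z => fderiv ℝ (f t) z (EuclideanSpace.single 0 1)) (axisPt y') :=
      (contDiff_hadamardQuotFst (n := ⊤) (hsm _)).continuous.comp continuous_axisPt
    have hcp : Continuous fun y' : EuclideanSpace ℝ (Fin 5) => fderiv ℝ (f t) (axisPt y') (V t (axisPt y')) :=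
      ((hft.continuous_fderiv (by simp)).comp continuous_axisPt).clm_apply
        ((hVc t ht).comp continuous_axisPt)
    exact (((hcii 0).add (hcii 2)).add (continuous_const.mul hcq)).sub hcp
  -- off the axis: divide KNSS (5.10) by `ϖ² = |P y|²`
  have hoff : ∀ y' : EuclideanSpace ℝ (Fin 5), horizProj y' ≠ 0 →
      deriv (fun s => f s (axisPt y')) t =
        (Δ (liftAx (f t))) y' - fderiv ℝ (liftAx (f t)) y'
          ((V t (axisPt y')) 0 • (‖horizProj y'‖⁻¹ • horizProj y') +
            (V t (axisPt y')) 2 • EuclideanSpace.single 4 (1 : ℝ)) := by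
    intro y' hy'
    have hρ : axisPt y' 0 ^ 2 + axisPt y' 1 ^ 2 ≠ 0 := by
      rw [axisPt_apply_zero, axisPt_apply_one]
      have h := norm_ne_zero_iff.2 hy'
      positivity
    have hsc := hscalar t ht (axisPt y')
    have hS5 := sq_mul_laplacian_liftAx hf4 (hfax t ht) y'
    rw [fderiv_liftAx hf2 h0 y', liftDeriv_apply_drift hf2 h0 h1 y' (V t (axisPt y'))]
    apply mul_left_cancel₀ hρ
    linear_combination hsc - hS5
  -- across the axis by continuity
  have hP : ∃ v : EuclideanSpace ℝ (Fin 5), horizProj v ≠ 0 :=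
    ⟨EuclideanSpace.single 0 1, by rw [horizProj_single_of_ne (by decide)]; simp⟩
  have hall := eq_of_eq_off_ker horizProj hP hg₁ hg₂ hoff y
  simp only at hall
  rw [← hall]
  exact hder

/-- **The lifted equation in the time-integrated form of `KNSS2009_lemma21_halfball`**: under the hypotheses of
`liftAx_hasDerivAt_of_scalarEq`, for `s ≤ t < 0` and every `y`,
`f̃(t,y) − f̃(s,y) = ∫ₛᵗ (Δ₅ f̃(τ)(y) − D f̃(τ)(y)[ã(τ,y)]) dτ` (fundamental theorem of calculus along the smooth time line).
[cite: KochNadirashviliSereginSverak2009, proof of Thm 5.2 (arXiv:0709.3599 p. 10)] -/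
theorem liftAx_sub_eq_integral_of_scalarEq (hfam : IsSmoothSpaceTimeOn (Iio 0) f)
    (hfax : ∀ t < 0, IsAxisymmetricScalar (f t)) (hVc : ∀ t < 0, Continuous (V t))
    (hscalar : ∀ t < 0, ∀ x : EuclideanSpace ℝ (Fin 3),
      (x 0 ^ 2 + x 1 ^ 2) * deriv (fun s => f s x) t =
        (x 0 ^ 2 + x 1 ^ 2) * ((Δ (f t)) x - fderiv ℝ (f t) x (V t x)) +
          2 * (x 0 * fderiv ℝ (f t) x (EuclideanSpace.single 0 1) +
            x 1 * fderiv ℝ (f t) x (EuclideanSpace.single 1 1)))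
    (y : EuclideanSpace ℝ (Fin 5)) {s t : ℝ} (hst : s ≤ t) (ht : t < 0) :
    liftAx (f t) y - liftAx (f s) y =
      ∫ τ in s..t, ((Δ (liftAx (f τ))) y - fderiv ℝ (liftAx (f τ)) y
        ((V τ (axisPt y)) 0 • (‖horizProj y‖⁻¹ • horizProj y) +
          (V τ (axisPt y)) 2 • EuclideanSpace.single 4 (1 : ℝ))) := by
  have hIcc : uIcc s t ⊆ Iio 0 := fun τ hτ => by
    rw [uIcc_of_le hst] at hτ
    exact hτ.2.trans_lt ht
  -- the time line and its continuous derivative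
  have hg : ∀ τ ∈ uIcc s t, HasDerivAt (fun σ => liftAx (f σ) y) (deriv (fun σ => f σ (axisPt y)) τ) τ :=
    fun τ hτ => hfam.hasDerivAt_timeLine isOpen_Iio (hIcc hτ) (axisPt y)
  have hD : IsSmoothSpaceTimeOn (Iio 0) fun σ x => deriv (fun σ' => f σ' x) σ := hfam.isSmoothSpaceTimeOn_deriv isOpen_Iio
  have hcont : ContinuousOn (fun τ => deriv (fun σ => f σ (axisPt y)) τ) (Iio 0) :=
    hD.continuousOn.comp (continuous_id.prodMk continuous_const).continuousOn fun τ hτ => ⟨hτ, mem_univ _⟩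
  have hint : IntervalIntegrable (fun τ => deriv (fun σ => f σ (axisPt y)) τ) volume s t :=
    (hcont.mono hIcc).intervalIntegrable
  rw [← intervalIntegral.integral_eq_sub_of_hasDerivAt hg hint]
  refine intervalIntegral.integral_congr fun τ hτ => ?_
  exact (hfam.hasDerivAt_timeLine isOpen_Iio (hIcc hτ) (axisPt y)).unique
    (liftAx_hasDerivAt_of_scalarEq hfam hfax hVc hscalar (hIcc hτ) y)

/-- **Joint measurability of the lifted drift, cut off at nonnegative times.**  For `V` jointly continuous on
`]−∞,0[ × ℝ³`, the field `ã(τ,y) = W₀ Py/|Py| + W₂ e₄`, `W = V(τ, axisPt y)` for `τ < 0` and `W = 0` otherwise, is jointly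
measurable on `ℝ × ℝ⁵` (`ContinuousOn.measurable_piecewise`). [folklore] -/
theorem measurable_cutDrift (hV : ContinuousOn (uncurry V) (Iio 0 ×ˢ univ)) :
    Measurable (uncurry fun (τ : ℝ) (y : EuclideanSpace ℝ (Fin 5)) =>
      ((if τ < 0 then V τ (axisPt y) else 0) 0) • (‖horizProj y‖⁻¹ • horizProj y) +
        ((if τ < 0 then V τ (axisPt y) else 0) 2) • EuclideanSpace.single 4 (1 : ℝ)) := by
  -- the cut-off meridian drift `W` is a piecewise of a continuous function and `0` along `{τ < 0}`
  have hW : Measurable fun p : ℝ × EuclideanSpace ℝ (Fin 5) => if p.1 < 0 then V p.1 (axisPt p.2) else 0 := by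
    have hs : MeasurableSet {p : ℝ × EuclideanSpace ℝ (Fin 5) | p.1 < 0} :=
      (isOpen_lt continuous_fst continuous_const).measurableSet
    have hc : ContinuousOn (fun p : ℝ × EuclideanSpace ℝ (Fin 5) => V p.1 (axisPt p.2))
        {p : ℝ × EuclideanSpace ℝ (Fin 5) | p.1 < 0} :=
      hV.comp (continuous_fst.prodMk (continuous_axisPt.comp continuous_snd)).continuousOn
        fun p hp => ⟨hp, mem_univ _⟩
    have e : (fun p : ℝ × EuclideanSpace ℝ (Fin 5) => if p.1 < 0 then V p.1 (axisPt p.2) else 0) =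
        {p : ℝ × EuclideanSpace ℝ (Fin 5) | p.1 < 0}.piecewise
          (fun p => V p.1 (axisPt p.2)) (fun _ => 0) := by
      funext p
      by_cases hp : p.1 < 0
      · rw [if_pos hp, Set.piecewise_eq_of_mem _ _ _ (by exact hp)]
      · rw [if_neg hp, Set.piecewise_eq_of_notMem _ _ _ (by exact hp)]
    rw [e]
    exact hc.measurable_piecewise continuousOn_const hs
  have h0c : Measurable fun p : ℝ × EuclideanSpace ℝ (Fin 5) => (if p.1 < 0 then V p.1 (axisPt p.2) else 0) 0 :=
    (EuclideanSpace.proj (0 : Fin 3)).continuous.measurable.comp hW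
  have h2c : Measurable fun p : ℝ × EuclideanSpace ℝ (Fin 5) => (if p.1 < 0 then V p.1 (axisPt p.2) else 0) 2 :=
    (EuclideanSpace.proj (2 : Fin 3)).continuous.measurable.comp hW
  have hP : Measurable fun p : ℝ × EuclideanSpace ℝ (Fin 5) => ‖horizProj p.2‖⁻¹ • horizProj p.2 :=
    ((horizProj.continuous.norm.measurable.comp measurable_snd).inv).smul
      (horizProj.continuous.measurable.comp measurable_snd)
  exact (h0c.smul hP).add (h2c.smul_const _)

end Lift

/-! ### FL-C -/

/-- **FL-C: zonal toroidal Liouville = the linear heart of KNSS Thm 5.2 with a given zonal drift.**  A toroidal field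
`B = ∇U × x` of a zonal potential `U`, jointly smooth and bounded with its derivatives on `]−∞,0[ × ℝ³`, transported (in the
un-curled potential form `(∂ₜU + V·∇U − ΔU)·x = ⟪V,x⟫ ∇U − ∇Π`) by a smooth bounded divergence-free axisymmetric drift `V`,
vanishes identically.  Proof: `B = f·J` with `f = B_φ/ϖ` smooth and axisymmetric; the induction equation (curl of the potential
form) paired with `Jx` is KNSS (5.10) for `f` with drift `V`; its `SO(4)`-lift `f̃` solves `∂ₜf̃ + ã·∇f̃ = Δ₅f̃` on
`]−∞,0[ × ℝ⁵` with `|y₀| |f̃| ≤ ‖B‖_∞`, and `KNSS2009_lemma21_halfball.eq_zero_of_abs_mul_le` (Lemma 2.1, proved in the tree as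
`KNSS2009_lemma21_halfball_holds`) forces `f̃ ≡ 0`, hence `f ≡ 0` and `B ≡ 0`.  The no-swirl hypothesis on `V` is idle.
This is ONE INPUT of the crux idea «capsym-comparison»; `PoloidalLiouville` (1222) and its wall stay OPEN.
[cite: KochNadirashviliSereginSverak2009, Thm 5.2 and its proof (arXiv:0709.3599 pp. 9–10; Acta Math. 203 pp. 97–98), Lemma 2.1 (arXiv p. 5)] -/
theorem zonalToroidalLiouville : ZonalToroidalLiouville := by
  intro V U P hV hU hP hVbd hdiv haxV _hsw haxU hBbd heq
  have hUst : IsSmoothSpaceTimeOn (Iio 0) U := hU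
  have hVst : IsSmoothSpaceTimeOn (Iio 0) V := hV
  choose C hC using hBbd
  obtain ⟨CV, hCV⟩ := hVbd 0
  -- slices
  have hUs : ∀ t < 0, ContDiff ℝ ∞ (U t) := fun t ht => hUst.contDiff_slice ht
  have hVs : ∀ t < 0, ContDiff ℝ ∞ (V t) := fun t ht => hVst.contDiff_slice ht
  have hBs : ∀ t < 0, ContDiff ℝ ∞ (fun y : EuclideanSpace ℝ (Fin 3) => cross (gradient (U t) y) y) :=
    fun t ht => (crossGradient_family hUst).contDiff_slice ht
  have hPd : ∀ t < 0, Differentiable ℝ (P t) := fun t ht => by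
    have hc : ContDiff ℝ 1 (fun x : EuclideanSpace ℝ (Fin 3) => ((t, x) : ℝ × EuclideanSpace ℝ (Fin 3))) :=
      contDiff_const.prodMk contDiff_id
    exact (hP.comp_contDiff hc fun x => mk_mem_prod ht (mem_univ x)).differentiable one_ne_zero
  -- the scalar family `f = B_φ/ϖ`
  have hfam : IsSmoothSpaceTimeOn (Iio 0) fun s =>
      hadamardQuotFst fun y : EuclideanSpace ℝ (Fin 3) => cross (gradient (U s) y) y 1 :=
    hadamardQuotFst_crossGradient_family hUst
  have hf : ∀ t < 0, ContDiff ℝ ∞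
      (hadamardQuotFst fun y : EuclideanSpace ℝ (Fin 3) => cross (gradient (U t) y) y 1) :=
    fun t ht => hfam.contDiff_slice ht
  have hfax : ∀ t < 0, IsAxisymmetricScalar
      (hadamardQuotFst fun y : EuclideanSpace ℝ (Fin 3) => cross (gradient (U t) y) y 1) := fun t ht =>
    isAxisymmetricScalar_hadamardQuotFst_cross_gradient ((hUs t ht).of_le (by norm_cast)) (haxU t ht)
  have hev : ∀ t < 0, IsEvenC 0
      (hadamardQuotFst fun y : EuclideanSpace ℝ (Fin 3) => cross (gradient (U t) y) y 1) :=
    fun t ht => (hfax t ht).isEvenC_zero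
  have hf4 : ∀ t < 0, ContDiff ℝ 4
      (hadamardQuotFst fun y : EuclideanSpace ℝ (Fin 3) => cross (gradient (U t) y) y 1) :=
    fun t ht => (hf t ht).of_le (by norm_cast)
  have hf2 : ∀ t < 0, ContDiff ℝ 2
      (hadamardQuotFst fun y : EuclideanSpace ℝ (Fin 3) => cross (gradient (U t) y) y 1) :=
    fun t ht => (hf t ht).of_le (by norm_cast)
  have h0 : ∀ t < 0, ∀ x : EuclideanSpace ℝ (Fin 3), x 0 = 0 →
      fderiv ℝ (hadamardQuotFst fun y : EuclideanSpace ℝ (Fin 3) => cross (gradient (U t) y) y 1) x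
        (EuclideanSpace.single 0 1) = 0 := fun t ht x hx =>
    (hev t ht).fderiv_single_zero_eq_zero ((hf t ht).differentiable (by simp)) hx
  have hBf : ∀ t < 0, ∀ x : EuclideanSpace ℝ (Fin 3), cross (gradient (U t) x) x =
      hadamardQuotFst (fun y : EuclideanSpace ℝ (Fin 3) => cross (gradient (U t) y) y 1) x • rotGen x :=
    fun t ht x => cross_gradient_eq_hadamardQuotFst_smul_rotGen ((hUs t ht).of_le (by norm_cast)) (haxU t ht) x
  -- bounds on `f` and its lift data from the bounds on `B`
  have hfB : ∀ t < 0, ∀ x : EuclideanSpace ℝ (Fin 3),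
      |hadamardQuotFst (fun y : EuclideanSpace ℝ (Fin 3) => cross (gradient (U t) y) y 1) x| ≤ C 1 ∧
      ‖fderiv ℝ (hadamardQuotFst fun y : EuclideanSpace ℝ (Fin 3) => cross (gradient (U t) y) y 1) x‖ ≤ C 2 ∧
      (∀ i : Fin 3, ‖fderiv ℝ (fun z => fderiv ℝ
        (hadamardQuotFst fun y : EuclideanSpace ℝ (Fin 3) => cross (gradient (U t) y) y 1) z
          (EuclideanSpace.single i 1)) x‖ ≤ C 3) ∧
      |hadamardQuotFst (fun z => fderiv ℝ
        (hadamardQuotFst fun y : EuclideanSpace ℝ (Fin 3) => cross (gradient (U t) y) y 1) z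
          (EuclideanSpace.single 0 1)) x| ≤ C 3 := fun t ht x =>
    hadamardQuotFst_apply_one_bounds (hBs t ht) (hC 1 t ht) (hC 2 t ht) (hC 3 t ht) x
  -- the cut drift and the scalar equation KNSS (5.10)
  have hVc : ∀ t < 0, Continuous fun x : EuclideanSpace ℝ (Fin 3) => if t < 0 then V t x else 0 := fun t ht => by
    simp only [if_pos ht]
    exact (hVs t ht).continuous
  have hscalar : ∀ t < 0, ∀ x : EuclideanSpace ℝ (Fin 3),
      (x 0 ^ 2 + x 1 ^ 2) *
          deriv (fun s => hadamardQuotFst (fun y : EuclideanSpace ℝ (Fin 3) => cross (gradient (U s) y) y 1) x) t =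
        (x 0 ^ 2 + x 1 ^ 2) *
            ((Δ (hadamardQuotFst fun y : EuclideanSpace ℝ (Fin 3) => cross (gradient (U t) y) y 1)) x -
              fderiv ℝ (hadamardQuotFst fun y : EuclideanSpace ℝ (Fin 3) => cross (gradient (U t) y) y 1) x
                (if t < 0 then V t x else 0)) +
          2 * (x 0 * fderiv ℝ (hadamardQuotFst fun y : EuclideanSpace ℝ (Fin 3) => cross (gradient (U t) y) y 1) x
                (EuclideanSpace.single 0 1) +
            x 1 * fderiv ℝ (hadamardQuotFst fun y : EuclideanSpace ℝ (Fin 3) => cross (gradient (U t) y) y 1) x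
                (EuclideanSpace.single 1 1)) := by
    intro t ht x
    rw [if_pos ht]
    have hind := inductionEquation_of_potentialForm hV hU hPd hdiv heq t ht x
    obtain ⟨-, hBt⟩ := deriv_cross_gradient_eq_deriv_smul_rotGen hUst haxU ht x
    rw [hBt] at hind
    have hsc := scalarEq_cross_gradient_of_inductionEq ((hUs t ht).of_le (by norm_cast)) (haxU t ht)
      ((hVs t ht).differentiable (by simp)) (haxV t ht) hind
    rwa [inner_smul_rotGen_rotGen] at hsc
  -- the lifted family `F` on `ℝ⁵` and the cut drift `a`
  set F : ℝ → EuclideanSpace ℝ (Fin 5) → ℝ := fun τ y =>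
    liftAx (hadamardQuotFst fun z : EuclideanSpace ℝ (Fin 3) => cross (gradient (U τ) z) z 1) y with hF_def
  set a : ℝ → EuclideanSpace ℝ (Fin 5) → EuclideanSpace ℝ (Fin 5) := fun τ y =>
    ((if τ < 0 then V τ (axisPt y) else 0) 0) • (‖horizProj y‖⁻¹ • horizProj y) +
      ((if τ < 0 then V τ (axisPt y) else 0) 2) • EuclideanSpace.single 4 (1 : ℝ) with ha_def
  -- the hypotheses of Lemma 2.1 (half-ball form)
  have ha_meas : Measurable (uncurry a) := measurable_cutDrift hVst.continuousOn
  have hVn : ∀ t < 0, ∀ x : EuclideanSpace ℝ (Fin 3), ‖V t x‖ ≤ CV := fun t ht x => by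
    have h := hCV t ht x
    rwa [norm_iteratedFDeriv_zero] at h
  have ha_bdd : ∀ t < 0, ∀ y, ‖a t y‖ ≤ 2 * CV := by
    intro t ht y
    have hunit : ‖‖horizProj y‖⁻¹ • horizProj y‖ ≤ 1 := by
      rw [norm_smul, norm_inv, norm_norm]
      by_cases h : ‖horizProj y‖ = 0
      · rw [h]; simp
      · rw [inv_mul_cancel₀ h]
    rw [ha_def]
    simp only [if_pos ht]
    have e0 : |V t (axisPt y) 0| ≤ CV :=
      le_trans (by simpa using PiLp.norm_apply_le (V t (axisPt y)) 0) (hVn t ht _)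
    have e2 : |V t (axisPt y) 2| ≤ CV :=
      le_trans (by simpa using PiLp.norm_apply_le (V t (axisPt y)) 2) (hVn t ht _)
    have hnn : 0 ≤ CV := (abs_nonneg _).trans e0
    calc ‖(V t (axisPt y)) 0 • (‖horizProj y‖⁻¹ • horizProj y) + (V t (axisPt y)) 2 • EuclideanSpace.single 4 (1 : ℝ)‖
        ≤ ‖(V t (axisPt y)) 0 • (‖horizProj y‖⁻¹ • horizProj y)‖ +
            ‖(V t (axisPt y)) 2 • EuclideanSpace.single 4 (1 : ℝ)‖ := norm_add_le _ _
      _ ≤ CV * 1 + CV * 1 := by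
          rw [norm_smul ((V t (axisPt y)) 0), norm_smul ((V t (axisPt y)) 2), Real.norm_eq_abs, Real.norm_eq_abs,
            PiLp.norm_single, norm_one]
          exact add_le_add (mul_le_mul e0 hunit (norm_nonneg _) hnn) (mul_le_mul_of_nonneg_right e2 zero_le_one)
      _ = 2 * CV := by ring
  have hF_bdd : ∃ C' : ℝ, ∀ t < 0, ∀ y, |F t y| ≤ C' := ⟨C 1, fun t ht y => (hfB t ht (axisPt y)).1⟩
  have hF2 : ∀ t < 0, ContDiff ℝ 2 (F t) := fun t ht => contDiff_two_liftAx (hf4 t ht) (hev t ht)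
  have hFD : ∃ C' : ℝ, ∀ t < 0, ∀ y, ‖fderiv ℝ (F t) y‖ ≤ C' ∧ |(Δ (F t)) y| ≤ C' := by
    refine ⟨max (2 * C 2) (5 * C 3), fun t ht y => ⟨?_, ?_⟩⟩
    · rw [show F t = liftAx (hadamardQuotFst fun z : EuclideanSpace ℝ (Fin 3) => cross (gradient (U t) z) z 1)
        from rfl, fderiv_liftAx (hf2 t ht) (h0 t ht)]
      exact (norm_liftDeriv_le (hf2 t ht) (h0 t ht) (fun x => (hfB t ht x).2.1) y).trans (le_max_left _ _)
    · exact (abs_laplacian_liftAx_le (hf4 t ht) (hev t ht) (fun i x => (hfB t ht x).2.2.1 i) y).trans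
        (le_max_right _ _)
  obtain ⟨hcontD, hcontΔ⟩ := liftAx_family_continuousOn_of_smooth hfam hfax
  have heq' : ∀ y, ∀ s t : ℝ, s ≤ t → t < 0 →
      F t y - F s y = ∫ τ in s..t, ((Δ (F τ)) y - fderiv ℝ (F τ) y (a τ y)) := fun y s t hst ht =>
    liftAx_sub_eq_integral_of_scalarEq (V := fun τ x => if τ < 0 then V τ x else 0) hfam hfax hVc hscalar y hst ht
  -- the obstruction `|y₀| |f̃| ≤ ϖ |f| = ‖B‖ ≤ C₀`
  have hK : ∀ t < 0, ∀ y, |y 0| * |F t y| ≤ C 0 := by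
    intro t ht y
    have h1 : |y 0| ≤ ‖horizProj y‖ := by
      have h := PiLp.norm_apply_le (horizProj y) 0
      rwa [Real.norm_eq_abs, horizProj_apply_of_ne (show (0 : Fin 5) ≠ 4 by decide)] at h
    have hJ : ‖rotGen (axisPt y)‖ = ‖horizProj y‖ := by
      have hsq : ‖rotGen (axisPt y)‖ ^ 2 = ‖horizProj y‖ ^ 2 := by
        rw [← real_inner_self_eq_norm_sq, inner_rotGen_self_eq, axisPt_apply_zero, axisPt_apply_one]; ring
      rw [← Real.sqrt_sq (norm_nonneg (rotGen (axisPt y))), hsq, Real.sqrt_sq (norm_nonneg _)]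
    have h2 : ‖horizProj y‖ * |F t y| = ‖cross (gradient (U t) (axisPt y)) (axisPt y)‖ := by
      have hF : F t y = hadamardQuotFst (fun z : EuclideanSpace ℝ (Fin 3) => cross (gradient (U t) z) z 1)
        (axisPt y) := rfl
      rw [hF, hBf t ht, norm_smul, Real.norm_eq_abs, hJ, mul_comm]
    have h3 : ‖cross (gradient (U t) (axisPt y)) (axisPt y)‖ ≤ C 0 := by
      have h := hC 0 t ht (axisPt y)
      rwa [norm_iteratedFDeriv_zero] at h
    calc |y 0| * |F t y| ≤ ‖horizProj y‖ * |F t y| := mul_le_mul_of_nonneg_right h1 (abs_nonneg _)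
      _ = ‖cross (gradient (U t) (axisPt y)) (axisPt y)‖ := h2
      _ ≤ _ := h3
  have hzero := KNSS2009_lemma21_halfball.eq_zero_of_abs_mul_le KNSS2009_lemma21_halfball_holds ha_meas ha_bdd
    hF_bdd hF2 hFD hcontD hcontΔ heq' hK
  -- conclusion: `f = 0`, `B = f J = 0`
  intro t ht x
  have hfx : hadamardQuotFst (fun z : EuclideanSpace ℝ (Fin 3) => cross (gradient (U t) z) z 1) x = 0 := by
    rw [(hfax t ht).eq_comp_meridian x, ← axisPt_lift_point x]
    exact hzero t ht _
  rw [hBf t ht x, hfx, zero_smul]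

end Summit.NavierStokesRegularity.NavierStokesRegularity.Theorems.PoloidalLiouville.CapSym

end
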